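import Literature.NumberTheory.EllipticCurves.SexticTwistLSeriesCoefficientsSplit
import Literature.NumberTheory.LFunctions.EisensteinGrossencharacterEuler
import Literature.NumberTheory.LFunctions.IdealNormCount
import HarnessLib

/-!
# Ireland–Rosen Ch. 18 §7 for `y² = x³ + k`: `a_n(E^k) = (k/n) · Σ_{N𝔞 = n} ψ_{4k}(𝔞) ϖ_𝔞` over the ideals of `ℤ[ω]`

Topic `Literature/NumberTheory/EllipticCurves`, namespace `Literature.NumberTheory.EllipticCurves.SexticTwist` (sequel to
`SexticTwistLSeriesCoefficients[Split]`).  Theorems only (no definition, no named fact).  The `j = 0` twin of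
`QuarticTwistHeckeCoefficients` (`a_n(E_D) = Σ_{N x = n} \overline{(D/x)₄} x` over `ℤ[i]`): the coefficientwise form of
«`L(E, s) = L(s, χ)`» for the Mordell curve `E^k = ⟨0, 0, 0, 0, k⟩`, read on the tree's carrier of `ℚ(ω)`
(`K3 = NumberFields.EisensteinField`, `𝓞 K3 = ℤ[ζ]`, embedding `e = EisensteinGrossen.embC`, primary generators
`ϖ_𝔞 = primGen 𝔞 ≡ 1 (mod 3)`, cubic symbol `ψ_D = EisensteinGrossen.psi D` — the Artin symbol of `K3(∛D)/K3`, `ψ_D(𝔭) = e(χ_𝔭(D))` —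
packaged with its support `(𝔞, 3D) = 1` as the Grössencharacter `grossenNu D 1 0` of `EisensteinGrossencharacterSums`).

For `k ∈ ℤ ∖ 0` free of sixth powers and NOT of the form `16u`, `u ≡ 1 (4)` (the one class with good reduction at `2`, where the
prime `2` is unramified in the character and the formula holds with `4k` replaced by `u = k/16`; not treated here):

  **`a_n(E^k) = (k/n) · Σ_{N𝔞 = n} ν_{4k}(𝔞) · e(ϖ_𝔞)`**,  `ν_{4k} = grossenNu (4k) 1 0`  (`lFunction_eq_jacobiSym_mul_sum`),

for every `n ≥ 1`, `(k/n)` the Jacobi symbol.  At a split prime `𝔭` this is `χ(𝔭) = (k/p)(4k/𝔭)₃ ϖ_𝔭 = −\overline{(4k/π)₆}π`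
(`π = −ϖ_𝔭 ≡ 2 (3)`), Ireland–Rosen's character of `y² = x³ + D`; at an inert `(p)`: `ν((p)) e(ϖ_{(p)}) = −p` and `(k/p²) = 1`;
at `𝔞` not prime to `12k`: `0` («if `P ∣ 6D` then `χ(P) = 0`»).  Proof as printed (Ch. 18 §7 with §6, PDF pp. 304–306): both
sides are multiplicative in `n` (Mathlib's `isMultiplicative_LFunction`; `twistCount_mul_of_coprime` — unique factorisation of
ideals, the tree's `IdealNormCount.equivProdOfCoprime`) and agree on prime powers by the Euler factors of
`SexticTwistLSeriesCoefficients[Split]` and the enumeration of the ideals of `ℤ[ω]` of norm `p^e` (`twistCount_prime_pow_eq_zero_of_dvd`,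
`twistCount_prime_pow_of_mod_three_eq_two`: `(p)^{e/2}`; `twistCount_prime_pow_split`: `𝔭^a 𝔭̄^{e−a}`).

* §1 `twistCount_mul_of_coprime`, `twistCount_prime_pow_eq_zero_of_dvd` (any number field);
* §2 the ideals of `ℤ[ω]` of prime-power norm: `eq_span_pow_of_absNorm_eq` (inert), `eq_pow_mul_pow_of_absNorm_eq` (split), and the
  prime-power values of `twistCount`;
* §3 the theorem.

## References
* K. Ireland, M. Rosen, *A Classical Introduction to Modern Number Theory*, 2nd ed., GTM 84 (1990), Ch. 18 §7 (`L(E, s) = L(s, χ)` for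
  `y² = x³ + D`) with §6 Theorem 7 and its proof (PDF pp. 304–306); Ch. 9 §1 Prop. 9.1.4 (primes of `ℤ[ω]`). [IrelandRosen1990]
* E. Hecke, *Eine neue Art von Zetafunktionen …* II, Math. Z. 6 (1920), §6. [HeckeMathZ1920]

## Mathlib / tree search
Tree: `SexticTwist.lFunction_apply_prime_pow_eq_zero/_of_mod_three_eq_two` (`SexticTwistLSeriesCoefficients`),
`lFunction_apply_prime_pow_split` (`…Split`); `EisensteinGrossen.{grossenNu, grossenNu_apply, grossenNu_span_natCast_of_mod_three_eq_two,
grossenNu_conjPrime, exists_split_data, primesOver, mem_primesOver, conjPrime, residueCard_conjPrime, primGen, primGen_eq_of, primGen_map_tau,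
primGen_span_natCast_of_mod_three_eq_two, embC, embC_tau, hζ, Adm}` (`EisensteinGrossencharacterSums/Euler`);
`K3.asIdeal_eq_of_mod_three_eq_two` (`EisensteinFieldPrimes`); `twistCount`, `idealsOfNorm`, `mem_idealsOfNorm`, `twistCount_zero/_one`
(`TwistedDedekindCoefficients`); `IdealNormCount.equivProdOfCoprime`, `absNorm_span_natCast` (`IdealNormCount`).  The statement
`twistCount_mul_of_coprime` also exists Summits-side (`Summit.ABC.….PeterssonJ0`, not importable here) and is re-proved.  Mathlib:
`ArithmeticFunction.IsMultiplicative.eq_iff_eq_on_prime_powers/intCast/iff_ne_zero`, `jacobiSym.mul_right'/pow_right`,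
`legendreSym.to_jacobiSym/sq_one`, `Finset.prod_multiset_count_of_subset`, `UniqueFactorizationMonoid.normalizedFactors_mul/_pow/_irreducible`,
`prod_normalizedFactors`, `Ideal.absNorm_mem`, `Ideal.exists_le_maximal`.
-/

noncomputable section

open scoped Classical ComplexConjugate

open NumberField IsDedekindDomain Finset UniqueFactorizationMonoid
open Literature.NumberTheory.NumberFields Literature.NumberTheory.NumberFields.K3
open Literature.NumberTheory.GaloisRepresentations
open Literature.NumberTheory.LFunctions Literature.NumberTheory.LFunctions.NumberField
open Literature.NumberTheory.LFunctions.EisensteinGrossen Literature.NumberTheory.LFunctions.PlaneLattice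

namespace Literature.NumberTheory.EllipticCurves

namespace SexticTwist

/-! ### §1 `twistCount` on coprime arguments and at the primes of the modulus (any number field) -/

section General

variable {K : Type*} [Field K] [NumberField K] (ν : Ideal (𝓞 K) →*₀ ℂ)

/-- `a_ν(n)` as a sum over the subtype of ideals of norm `n`. [folklore] -/
private theorem twistCount_eq_sum_subtype (n : ℕ) [Fintype {I : Ideal (𝓞 K) // Ideal.absNorm I = n}] :
    twistCount K ν n = ∑ I : {I : Ideal (𝓞 K) // Ideal.absNorm I = n}, ν I.1 := by
  rw [twistCount]
  exact Finset.sum_subtype (idealsOfNorm K n) (fun _ ↦ mem_idealsOfNorm) _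

/-- **`a_ν(mn) = a_ν(m) a_ν(n)` for coprime `m, n`** («`∏_P (1 − χ(P)NP^{−s})⁻¹ = Σ_A χ(A) NA^{−s}`»: multiplicativity of `ν`
and the bijection `{N(I) = mn} ≃ {N(A) = m} × {N(B) = n}`, `I ↦ (I + (m), I + (n))` — the tree's `IdealNormCount.equivProdOfCoprime`).
(The same statement is proved Summits-side as `Summit.ABC.….PeterssonJ0.twistCount_mul_of_coprime`, not importable under `Literature/`;
kept private here.) [cite: IrelandRosen1990, Ch. 18 §6, proof of Theorem 7 (PDF p. 304)] -/
private theorem twistCount_mul_of_coprime {m n : ℕ} (h : m.Coprime n) :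
    twistCount K ν (m * n) = twistCount K ν m * twistCount K ν n := by
  rcases Nat.eq_zero_or_pos m with rfl | hm
  · have hn : n = 1 := by simpa using h
    subst hn
    simp [twistCount_one, twistCount_zero]
  rcases Nat.eq_zero_or_pos n with rfl | hn
  · have hm1 : m = 1 := by simpa using h
    subst hm1
    simp [twistCount_one, twistCount_zero]
  letI : Fintype {I : Ideal (𝓞 K) // Ideal.absNorm I = m * n} :=
    Fintype.ofFinset (idealsOfNorm K (m * n)) (fun _ ↦ mem_idealsOfNorm)
  letI : Fintype {I : Ideal (𝓞 K) // Ideal.absNorm I = m} := Fintype.ofFinset (idealsOfNorm K m) (fun _ ↦ mem_idealsOfNorm)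
  letI : Fintype {I : Ideal (𝓞 K) // Ideal.absNorm I = n} := Fintype.ofFinset (idealsOfNorm K n) (fun _ ↦ mem_idealsOfNorm)
  rw [twistCount_eq_sum_subtype ν (m * n), twistCount_eq_sum_subtype ν m, twistCount_eq_sum_subtype ν n, Finset.sum_mul_sum,
    ← Fintype.sum_prod_type']
  symm
  refine Fintype.sum_equiv (IdealNormCount.equivProdOfCoprime K hm hn h).symm
    (fun AB ↦ ν AB.1.1 * ν AB.2.1) (fun I ↦ ν I.1) fun AB ↦ ?_
  rw [← map_mul]
  rfl

/-- A prime ideal whose norm divides `p^e` contains `p` (`N𝔭 = p^f ∈ 𝔭`, `f ≥ 1`). [cite: IrelandRosen1990, Ch. 9 §1 Prop. 9.1.4] -/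
theorem natCast_mem_of_absNorm_dvd_prime_pow {p : ℕ} (hp : p.Prime) {e : ℕ} {P : Ideal (𝓞 K)} (hP : P.IsPrime)
    (hdvd : Ideal.absNorm P ∣ p ^ e) : (p : 𝓞 K) ∈ P := by
  obtain ⟨j, -, hPj⟩ := (Nat.dvd_prime_pow hp).mp hdvd
  have hj : j ≠ 0 := by
    rintro rfl
    rw [pow_zero, Ideal.absNorm_eq_one_iff] at hPj
    exact hP.ne_top hPj
  have hmem : ((Ideal.absNorm P : ℕ) : 𝓞 K) ∈ P := Ideal.absNorm_mem P
  rw [hPj, Nat.cast_pow] at hmem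
  exact hP.mem_of_pow_mem j hmem

/-- **`a_ν(p^e) = 0` (`e ≥ 1`) at a prime `p ∣ M` when `ν` vanishes off the ideals prime to `(M)`** («if `P ∣ 6D` define `χ(P) = 0`»:
every ideal of norm `p^e` lies in a prime over `p ∋ M`). [cite: IrelandRosen1990, Ch. 18 §6–§7 («if `P` divides `2D` define `χ(P) = 0`»)] -/
theorem twistCount_prime_pow_eq_zero_of_dvd {M : 𝓞 K} (hν : ∀ I, ¬ IsCoprime I (Ideal.span {M}) → ν I = 0) {p : ℕ}
    (hp : p.Prime) (hpM : (p : 𝓞 K) ∣ M) {e : ℕ} (he : e ≠ 0) : twistCount K ν (p ^ e) = 0 := by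
  rw [twistCount]
  refine Finset.sum_eq_zero fun I hI ↦ hν I fun hcop ↦ ?_
  rw [mem_idealsOfNorm] at hI
  have hI1 : I ≠ ⊤ := by
    intro h
    rw [h, Ideal.absNorm_top] at hI
    exact (Nat.one_lt_pow he hp.one_lt).ne hI
  obtain ⟨P, hPmax, hIP⟩ := Ideal.exists_le_maximal I hI1
  have hpP : (p : 𝓞 K) ∈ P :=
    natCast_mem_of_absNorm_dvd_prime_pow hp hPmax.isPrime (hI ▸ Ideal.absNorm_dvd_absNorm_of_le hIP)
  have hMP : M ∈ P := by
    obtain ⟨t, rfl⟩ := hpM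
    exact P.mul_mem_right t hpP
  rw [Ideal.isCoprime_iff_sup_eq] at hcop
  have hle : I ⊔ Ideal.span {M} ≤ P := sup_le hIP ((Ideal.span_singleton_le_iff_mem _).mpr hMP)
  rw [hcop, top_le_iff] at hle
  exact hPmax.ne_top hle

end General

/-! ### §2 The ideals of `ℤ[ω]` of prime-power norm, and `a_ν(p^e)` at inert and split primes -/

section K3

variable (ν : Ideal (𝓞 K3) →*₀ ℂ)

/-- A prime factor of an ideal of `𝓞 K3` of norm `p^e` is a prime over `p`. [cite: IrelandRosen1990, Ch. 9 §1 Prop. 9.1.4] -/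
theorem mem_primesOver_of_mem_normalizedFactors {p : ℕ} (hp : p.Prime) {e : ℕ} {I : Ideal (𝓞 K3)}
    (hI : Ideal.absNorm I = p ^ e) {Q : Ideal (𝓞 K3)} (hQ : Q ∈ normalizedFactors I) :
    ∃ v : HeightOneSpectrum (𝓞 K3), v ∈ primesOver p ∧ v.asIdeal = Q := by
  have hI0 : I ≠ ⊥ := by
    intro h; rw [h, Ideal.absNorm_bot] at hI; exact pow_ne_zero e hp.ne_zero hI.symm
  have hQprime : Q.IsPrime := Ideal.isPrime_of_prime (prime_of_normalized_factor Q hQ)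
  have hQ0 : Q ≠ ⊥ := (prime_of_normalized_factor Q hQ).ne_zero
  have hIQ : I ≤ Q := Ideal.le_of_dvd (dvd_of_mem_normalizedFactors hQ)
  refine ⟨⟨Q, hQprime, hQ0⟩, ?_, rfl⟩
  rw [mem_primesOver hp]
  push_cast
  exact natCast_mem_of_absNorm_dvd_prime_pow hp hQprime (hI ▸ Ideal.absNorm_dvd_absNorm_of_le hIQ)

/-- **Inert primes: an ideal of `ℤ[ω]` of norm `p^e`, `p ≡ 2 (3)`, is `(p)^{e/2}` with `e` even** (the only prime over `p` is `(p)`,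
of norm `p²`). [cite: IrelandRosen1990, Ch. 9 §1 Prop. 9.1.4] -/
theorem eq_span_pow_of_absNorm_eq {p : ℕ} (hp : p.Prime) (hp3 : p % 3 = 2) {e : ℕ} {I : Ideal (𝓞 K3)}
    (hI : Ideal.absNorm I = p ^ e) : ∃ c : ℕ, I = Ideal.span {((p : ℤ) : 𝓞 K3)} ^ c ∧ e = 2 * c := by
  have hI0 : I ≠ ⊥ := by
    intro h; rw [h, Ideal.absNorm_bot] at hI; exact pow_ne_zero e hp.ne_zero hI.symm
  set s := normalizedFactors I with hs
  set P₀ : Ideal (𝓞 K3) := Ideal.span {((p : ℤ) : 𝓞 K3)} with hP₀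
  have hall : ∀ Q ∈ s, Q = P₀ := by
    intro Q hQ
    obtain ⟨v, hv, rfl⟩ := mem_primesOver_of_mem_normalizedFactors hp hI hQ
    exact asIdeal_eq_of_mod_three_eq_two hp hp3 v ((mem_primesOver hp).mp hv)
  have hsrep : s = Multiset.replicate (Multiset.card s) P₀ := Multiset.eq_replicate.mpr ⟨rfl, hall⟩
  have hprod : I = P₀ ^ Multiset.card s := by
    rw [← associated_iff_eq.mp (prod_normalizedFactors hI0), ← hs, hsrep, Multiset.prod_replicate, Multiset.card_replicate]
  refine ⟨Multiset.card s, hprod, ?_⟩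
  have hN : Ideal.absNorm I = p ^ (2 * Multiset.card s) := by
    rw [hprod, map_pow, EisensteinGrossen.absNorm_span_natCast, ← pow_mul]
  rw [hI] at hN
  exact Nat.pow_right_injective hp.two_le hN

/-- **`a_ν(p^{2t}) = ν((p))^t` and `a_ν(p^{2t+1}) = 0` at an inert prime `p ≡ 2 (3)`** (the ideals of norm `p^{2t}` resp. `p^{2t+1}`
are `{(p)^t}` resp. none). [cite: IrelandRosen1990, Ch. 18 §6, proof of Theorem 7, case of an inert prime (PDF p. 304)] -/
theorem twistCount_prime_pow_of_mod_three_eq_two {p : ℕ} (hp : p.Prime) (hp3 : p % 3 = 2) (t : ℕ) :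
    twistCount K3 ν (p ^ (2 * t)) = ν (Ideal.span {((p : ℤ) : 𝓞 K3)}) ^ t ∧ twistCount K3 ν (p ^ (2 * t + 1)) = 0 := by
  set P₀ : Ideal (𝓞 K3) := Ideal.span {((p : ℤ) : 𝓞 K3)} with hP₀
  have hNP : ∀ c : ℕ, Ideal.absNorm (P₀ ^ c) = p ^ (2 * c) := fun c ↦ by
    rw [map_pow, EisensteinGrossen.absNorm_span_natCast, ← pow_mul]
  constructor
  · have hset : idealsOfNorm K3 (p ^ (2 * t)) = {P₀ ^ t} := by
      ext I
      rw [mem_idealsOfNorm, Finset.mem_singleton]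
      constructor
      · intro hI
        obtain ⟨c, hIc, hec⟩ := eq_span_pow_of_absNorm_eq hp hp3 hI
        have : c = t := by omega
        rw [hIc, this]
      · rintro rfl; exact hNP t
    rw [twistCount, hset, Finset.sum_singleton, map_pow]
  · rw [twistCount]
    refine Finset.sum_eq_zero fun I hI ↦ ?_
    rw [mem_idealsOfNorm] at hI
    obtain ⟨c, -, hec⟩ := eq_span_pow_of_absNorm_eq hp hp3 hI
    omega

/-- The normalised factorisation of `𝔭^a 𝔮^b` for distinct primes. [cite: IrelandRosen1990, Ch. 9 §1 Prop. 9.1.4] -/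
private theorem normalizedFactors_pow_mul_pow (v w : HeightOneSpectrum (𝓞 K3)) (a b : ℕ) :
    normalizedFactors (v.asIdeal ^ a * w.asIdeal ^ b) = Multiset.replicate a v.asIdeal + Multiset.replicate b w.asIdeal := by
  have hv : normalizedFactors v.asIdeal = {v.asIdeal} := by
    rw [normalizedFactors_irreducible v.irreducible, normalize_eq]
  have hw : normalizedFactors w.asIdeal = {w.asIdeal} := by
    rw [normalizedFactors_irreducible w.irreducible, normalize_eq]
  rw [normalizedFactors_mul (pow_ne_zero _ v.ne_bot) (pow_ne_zero _ w.ne_bot), normalizedFactors_pow, normalizedFactors_pow, hv, hw,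
    Multiset.nsmul_singleton, Multiset.nsmul_singleton]

/-- **Split primes: an ideal of `ℤ[ω]` of norm `p^e` is `𝔭^a 𝔭̄^b` with `a + b = e`** when the primes over `p` are `𝔭 ≠ 𝔭̄` of norm
`p`; here `a`, `b` are the multiplicities of `𝔭`, `𝔭̄` in the factorisation. [cite: IrelandRosen1990, Ch. 9 §1 Prop. 9.1.4] -/
theorem eq_pow_mul_pow_of_absNorm_eq {p : ℕ} (hp : p.Prime) {v : HeightOneSpectrum (𝓞 K3)} (hvw : v ≠ conjPrime v)
    (hfib : primesOver p = {v, conjPrime v}) (hdeg : v.residueCard = p) {e : ℕ} {I : Ideal (𝓞 K3)} (hI : Ideal.absNorm I = p ^ e) :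
    I = v.asIdeal ^ (normalizedFactors I).count v.asIdeal * (conjPrime v).asIdeal ^ (normalizedFactors I).count (conjPrime v).asIdeal ∧
      (normalizedFactors I).count v.asIdeal + (normalizedFactors I).count (conjPrime v).asIdeal = e := by
  have hI0 : I ≠ ⊥ := by
    intro h; rw [h, Ideal.absNorm_bot] at hI; exact pow_ne_zero e hp.ne_zero hI.symm
  set s := normalizedFactors I with hs
  set w := conjPrime v with hw
  have hne : v.asIdeal ≠ w.asIdeal := fun h ↦ hvw (HeightOneSpectrum.ext h)
  have hsub : s.toFinset ⊆ {v.asIdeal, w.asIdeal} := by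
    intro Q hQ
    rw [Multiset.mem_toFinset] at hQ
    obtain ⟨u, hu, rfl⟩ := mem_primesOver_of_mem_normalizedFactors hp hI hQ
    rw [hfib, Finset.mem_insert, Finset.mem_singleton] at hu
    rw [Finset.mem_insert, Finset.mem_singleton]
    rcases hu with rfl | rfl
    · exact Or.inl rfl
    · exact Or.inr rfl
  have hprod : I = v.asIdeal ^ s.count v.asIdeal * w.asIdeal ^ s.count w.asIdeal := by
    rw [← associated_iff_eq.mp (prod_normalizedFactors hI0), ← hs, Finset.prod_multiset_count_of_subset s _ hsub,
      Finset.prod_pair hne]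
  have hNv : Ideal.absNorm v.asIdeal = p := hdeg
  have hNw : Ideal.absNorm w.asIdeal = p := by rw [hw]; exact (residueCard_conjPrime v).trans hdeg
  refine ⟨hprod, ?_⟩
  have hN : Ideal.absNorm I = p ^ (s.count v.asIdeal + s.count w.asIdeal) := by
    rw [hprod, map_mul, map_pow, map_pow, hNv, hNw, ← pow_add]
  rw [hI] at hN
  exact (Nat.pow_right_injective hp.two_le hN).symm

/-- **`a_ν(p^e) = Σ_{a ≤ e} ν(𝔭)^a ν(𝔭̄)^{e−a}` at a split prime** («`(1 − χ(P)NP^{−s})(1 − χ(P̄)NP̄^{−s})`»: the ideals of norm `p^e`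
are the `e + 1` ideals `𝔭^a 𝔭̄^{e−a}`). [cite: IrelandRosen1990, Ch. 18 §6, proof of Theorem 7, case of a split prime (PDF p. 304)] -/
theorem twistCount_prime_pow_split {p : ℕ} (hp : p.Prime) {v : HeightOneSpectrum (𝓞 K3)} (hvw : v ≠ conjPrime v)
    (hfib : primesOver p = {v, conjPrime v}) (hdeg : v.residueCard = p) (e : ℕ) :
    twistCount K3 ν (p ^ e) = ∑ a ∈ Finset.range (e + 1), ν v.asIdeal ^ a * ν (conjPrime v).asIdeal ^ (e - a) := by
  set w := conjPrime v with hw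
  have hne : v.asIdeal ≠ w.asIdeal := fun h ↦ hvw (HeightOneSpectrum.ext h)
  have hNv : Ideal.absNorm v.asIdeal = p := hdeg
  have hNw : Ideal.absNorm w.asIdeal = p := by rw [hw]; exact (residueCard_conjPrime v).trans hdeg
  rw [twistCount]
  refine Finset.sum_nbij' (fun I ↦ (normalizedFactors I).count v.asIdeal) (fun a ↦ v.asIdeal ^ a * w.asIdeal ^ (e - a))
    ?_ ?_ ?_ ?_ ?_
  · intro I hI
    rw [mem_idealsOfNorm] at hI
    have h : (normalizedFactors I).count v.asIdeal + (normalizedFactors I).count w.asIdeal = e :=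
      (eq_pow_mul_pow_of_absNorm_eq hp hvw hfib hdeg hI).2
    rw [Finset.mem_range]; omega
  · intro a ha
    rw [Finset.mem_range] at ha
    rw [mem_idealsOfNorm, map_mul, map_pow, map_pow, hNv, hNw, ← pow_add]
    congr 1; omega
  · intro I hI
    rw [mem_idealsOfNorm] at hI
    obtain ⟨hprod, hsum⟩ := eq_pow_mul_pow_of_absNorm_eq hp hvw hfib hdeg hI
    have hsum' : (normalizedFactors I).count v.asIdeal + (normalizedFactors I).count w.asIdeal = e := hsum
    rw [show e - (normalizedFactors I).count v.asIdeal = (normalizedFactors I).count w.asIdeal by omega]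
    exact hprod.symm
  · intro a ha
    rw [normalizedFactors_pow_mul_pow, Multiset.count_add, Multiset.count_replicate_self, Multiset.count_replicate,
      if_neg hne.symm, add_zero]
  · intro I hI
    rw [mem_idealsOfNorm] at hI
    obtain ⟨hprod, hsum⟩ := eq_pow_mul_pow_of_absNorm_eq hp hvw hfib hdeg hI
    have hsum' : (normalizedFactors I).count v.asIdeal + (normalizedFactors I).count w.asIdeal = e := hsum
    conv_lhs => rw [hprod]
    rw [map_mul, map_pow, map_pow, show e - (normalizedFactors I).count v.asIdeal = (normalizedFactors I).count w.asIdeal by omega]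

end K3

/-! ### §3 `a_n(E^k) = (k/n) · Σ_{N𝔞 = n} ν_{4k}(𝔞) e(ϖ_𝔞)` -/

section Main

variable {k : ℤ}

/-- `Real.sqrt`-free bookkeeping: `ψ`-with-support times the primary generator is multiplicative on ideals (on non-admissible
ideals the first factor vanishes). [cite: HeckeMathZ1920, §6] -/
private theorem weight_mul (D : 𝓞 K3) (I J : Ideal (𝓞 K3)) :
    grossenNu D 1 0 (I * J) * embC (primGen (I * J) : K3) =
      (grossenNu D 1 0 I * embC (primGen I : K3)) * (grossenNu D 1 0 J * embC (primGen J : K3)) := by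
  by_cases hI : Adm D I
  · by_cases hJ : Adm D J
    · rw [map_mul, primGen_mul hI.coprime_three hJ.coprime_three]
      push_cast
      rw [map_mul]; ring
    · have hIJ : ¬ Adm D (I * J) := fun h ↦ hJ ((adm_mul_iff D).mp h).2
      rw [grossenNu_apply, if_neg hIJ, grossenNu_apply D 1 0 J, if_neg hJ]; ring
  · have hIJ : ¬ Adm D (I * J) := fun h ↦ hI ((adm_mul_iff D).mp h).1
    rw [grossenNu_apply, if_neg hIJ, grossenNu_apply D 1 0 I, if_neg hI]; ring

/-- The value of the weight at the inert prime `(p)`, `p ≡ 2 (3)` odd, `p ∤ 3D`: `ν_D((p)) e(ϖ_{(p)}) = −p` (`χ_{(p)}(D) = 1`,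
`ϖ_{(p)} = −p`). [cite: IrelandRosen1990, Ch. 18 §7 («`χ(P) = −p` for `P = (p)`, `p ≡ 2 (3)`»)] -/
theorem weight_span_natCast_of_mod_three_eq_two {p : ℕ} (hp : p.Prime) (hp3 : p % 3 = 2) (hp2 : p ≠ 2) {d : ℤ}
    (hd : ¬ (p : ℤ) ∣ 3 * d) :
    grossenNu ((d : ℤ) : 𝓞 K3) 1 0 (Ideal.span {((p : ℤ) : 𝓞 K3)}) * embC (primGen (Ideal.span {((p : ℤ) : 𝓞 K3)}) : K3) = -p := by
  rw [grossenNu_span_natCast_of_mod_three_eq_two hp hp3 hp2 hd 1 0, pow_zero, one_mul, primGen_span_natCast_of_mod_three_eq_two hp3]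
  simp

/-- **Ireland–Rosen Ch. 18 §7, coefficientwise: `a_n(E^k) = (k/n) · Σ_{N𝔞 = n} ν_{4k}(𝔞) e(ϖ_𝔞)`** for every `n`, `k ∈ ℤ ∖ 0` free of
sixth powers and not of the form `16u` with `u ≡ 1 (4)` (`E^k = mordellCurve k : y² = x³ + k`; `ν_{4k} = grossenNu (4k) 1 0` the cubic
symbol `𝔞 ↦ (4k/𝔞)₃` with support `(𝔞, 12k) = 1`; `ϖ_𝔞 ≡ 1 (3)` the primary generator; `(k/n)` the Jacobi symbol; `e : K3 → ℂ`).
Both sides are multiplicative and agree on prime powers: `0` at `p ∣ 6k` and at `2`; `(−p)^{e/2}` or `0` at inert `p`;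
`Σ_{a ≤ e} z^a z̄^{e−a}`, `z = (k/p)(4k/𝔭)₃ e(ϖ_𝔭)`, at split `p` (Theorem 18.4).
[cite: IrelandRosen1990, Ch. 18 §7 with §6 Theorem 7 and its proof (PDF pp. 304–306)] -/
theorem lFunction_eq_jacobiSym_mul_sum (hk : k ≠ 0) (h6 : ∀ q : ℕ, q.Prime → ¬ (q : ℤ) ^ 6 ∣ k)
    (h2 : ¬ ∃ u : ℤ, u % 4 = 1 ∧ k = 16 * u) (n : ℕ) :
    ((mordellCurve (k : ℚ)).LFunction n : ℂ) =
      (jacobiSym k n : ℂ) * ∑ I ∈ idealsOfNorm K3 n, grossenNu ((4 * k : ℤ) : 𝓞 K3) 1 0 I * embC (primGen I : K3) := by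
  set D : 𝓞 K3 := ((4 * k : ℤ) : 𝓞 K3) with hD
  -- the weight as a homomorphism on ideals, and the two arithmetic functions
  let ν : Ideal (𝓞 K3) →*₀ ℂ :=
    { toFun := fun I ↦ grossenNu D 1 0 I * embC (primGen I : K3)
      map_zero' := by show grossenNu D 1 0 0 * _ = 0; rw [map_zero, zero_mul]
      map_one' := by show grossenNu D 1 0 1 * embC (primGen 1 : K3) = 1; rw [map_one, Ideal.one_eq_top, primGen_top]; simp
      map_mul' := fun I J ↦ weight_mul D I J }
  have hν : ∀ I, ν I = grossenNu D 1 0 I * embC (primGen I : K3) := fun I ↦ rfl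
  have hνsupp : ∀ I, ¬ IsCoprime I (Ideal.span {3 * D}) → ν I = 0 := fun I hI ↦ by
    rw [hν, grossenNu_apply, if_neg (fun h ↦ hI h.2), zero_mul]
  set f : ArithmeticFunction ℂ := ((mordellCurve (k : ℚ)).LFunction : ArithmeticFunction ℂ) with hf
  let g : ArithmeticFunction ℂ := ⟨fun n ↦ (jacobiSym k n : ℂ) * twistCount K3 ν n, by simp [twistCount_zero]⟩
  have hg : ∀ n, g n = (jacobiSym k n : ℂ) * twistCount K3 ν n := fun n ↦ rfl
  have hfn : ∀ n, f n = ((mordellCurve (k : ℚ)).LFunction n : ℂ) := fun n ↦ ArithmeticFunction.intCoe_apply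
  -- multiplicativity
  have hfmul : f.IsMultiplicative := (mordellCurve (k : ℚ)).isMultiplicative_LFunction.intCast
  have hgmul : g.IsMultiplicative := by
    refine ArithmeticFunction.IsMultiplicative.iff_ne_zero.mpr ⟨?_, ?_⟩
    · rw [hg, jacobiSym.one_right, twistCount_one]; simp
    · intro m n hm hn hmn
      rw [hg, hg, hg, jacobiSym.mul_right' k hm hn, twistCount_mul_of_coprime ν hmn]
      push_cast; ring
  -- agreement on prime powers
  suffices H : f = g by
    have := congrArg (fun h : ArithmeticFunction ℂ ↦ h n) H
    simp only [hfn, hg, twistCount, hν] at this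
    exact this
  refine (ArithmeticFunction.IsMultiplicative.eq_iff_eq_on_prime_powers f hfmul g hgmul).mpr fun p i hp ↦ ?_
  haveI : Fact p.Prime := ⟨hp⟩
  rcases i with _ | j
  · rw [pow_zero, hfmul.map_one, hgmul.map_one]
  rw [hfn, hg]
  -- (a) the additive primes: `p ∣ 6k` or `p = 2`
  by_cases hbad : p = 3 ∨ (5 ≤ p ∧ (p : ℤ) ∣ k) ∨ p = 2
  · have hcase : p = 3 ∨ (5 ≤ p ∧ (p : ℤ) ∣ k) ∨ (p = 2 ∧ ¬ ∃ u : ℤ, u % 4 = 1 ∧ k = 16 * u) := by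
      rcases hbad with h | h | h
      · exact Or.inl h
      · exact Or.inr (Or.inl h)
      · exact Or.inr (Or.inr ⟨h, h2⟩)
    have hpM : (p : 𝓞 K3) ∣ 3 * D := by
      rcases hbad with rfl | ⟨-, hpk⟩ | rfl
      · exact dvd_mul_right _ _
      · obtain ⟨t, rfl⟩ := hpk
        refine ⟨((12 * t : ℤ) : 𝓞 K3), ?_⟩
        rw [hD]; push_cast; ring
      · refine ⟨((6 * k : ℤ) : 𝓞 K3), ?_⟩
        rw [hD]; push_cast; ring
    rw [lFunction_apply_prime_pow_eq_zero hk h6 hp hcase j, twistCount_prime_pow_eq_zero_of_dvd ν hνsupp hp hpM (Nat.succ_ne_zero j)]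
    simp
  push Not at hbad
  obtain ⟨hp3', hp5, hp2⟩ := hbad
  have hp5' : 5 ≤ p := by
    by_contra hlt
    have h2le := hp.two_le
    interval_cases p
    · exact hp2 rfl
    · exact hp3' rfl
    · exact absurd hp (by decide)
  have hpk : ¬ (p : ℤ) ∣ k := hp5 hp5'
  have hp12 : ¬ (p : ℤ) ∣ 3 * (4 * k) := by
    intro h
    have hp' : Prime (p : ℤ) := Nat.prime_iff_prime_int.mp hp
    rcases hp'.dvd_or_dvd h with h3 | h4k
    · have : p ∣ 3 := by exact_mod_cast h3
      exact hp3' ((Nat.prime_dvd_prime_iff_eq hp Nat.prime_three).mp this)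
    · rcases hp'.dvd_or_dvd h4k with h4 | hk'
      · have : p ∣ 2 ^ 2 := by exact_mod_cast h4
        exact hp2 ((Nat.prime_dvd_prime_iff_eq hp Nat.prime_two).mp (hp.dvd_of_dvd_pow this))
      · exact hpk hk'
  rcases Nat.lt_or_ge (p % 3) 2 with hlt | hge
  swap
  · -- (b) inert primes `p ≡ 2 (3)`, `p` odd, `p ∤ k`
    have hp3 : p % 3 = 2 := by omega
    obtain ⟨m, hm | hm⟩ := Nat.even_or_odd' (j + 1)
    · rw [hm, (lFunction_apply_prime_pow_of_mod_three_eq_two hp hp3 hp2 hpk m).1,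
        (twistCount_prime_pow_of_mod_three_eq_two ν hp hp3 m).1, hν, hD, weight_span_natCast_of_mod_three_eq_two hp hp3 hp2 hp12,
        jacobiSym.pow_right, ← jacobiSym.legendreSym.to_jacobiSym, pow_mul, legendreSym.sq_one p (by rwa [Ne, ZMod.intCast_zmod_eq_zero_iff_dvd])]
      push_cast; ring
    · rw [hm, (lFunction_apply_prime_pow_of_mod_three_eq_two hp hp3 hp2 hpk m).2,
        (twistCount_prime_pow_of_mod_three_eq_two ν hp hp3 m).2]
      simp
  · -- (c) split primes `p ≡ 1 (3)`
    have hp3 : p % 3 = 1 := by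
      have h0 : p % 3 ≠ 0 := fun h0 ↦ hp3' ((Nat.prime_dvd_prime_iff_eq Nat.prime_three hp).mp (Nat.dvd_of_mod_eq_zero h0)).symm
      omega
    obtain ⟨v, ϖ, hvw, hfib, hpv, hdeg, -, hϖ, hϖ1, hnorm, hval⟩ := exists_split_data hp hp3
    have hpv' : (p : 𝓞 K3) ∈ v.asIdeal := by have h := hpv; rwa [Int.cast_natCast] at h
    -- E-side
    rw [lFunction_apply_prime_pow_split (K := K3) EisensteinGrossen.hζ hp3 hpk embC.toRingHom hpv' hdeg hϖ hϖ1 (j + 1)]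
    -- character side
    rw [twistCount_prime_pow_split ν hp hvw hfib hdeg (j + 1)]
    have hνv : ν v.asIdeal = embC ((cubicResidueSymbol v (Ideal.Quotient.mk v.asIdeal D) : 𝓞 K3) : K3) * embC (ϖ : K3) := by
      have hcop : IsCoprime v.asIdeal three := by rw [← hϖ]; exact isCoprime_three_of_sub_one_mem hϖ1
      rw [hν, hD, hval (4 * k) 1 0 hp12, pow_one, sectorWeight, pow_zero, mul_one, primGen_eq_of hcop hϖ hϖ1]
    have hνw : ν (conjPrime v).asIdeal = conj (ν v.asIdeal) := by
      rw [hν, hν, hD, grossenNu_conjPrime, conjPrime_asIdeal,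
        primGen_map_tau (by rw [← hϖ]; exact isCoprime_three_of_sub_one_mem hϖ1), embC_tau, map_mul]
    have hreal : conj ((legendreSym p k : ℤ) : ℂ) = ((legendreSym p k : ℤ) : ℂ) := map_intCast _ _
    rw [Finset.mul_sum]
    refine Finset.sum_congr rfl fun a ha ↦ ?_
    rw [Finset.mem_range] at ha
    have hcast : Ideal.Quotient.mk v.asIdeal D = Ideal.Quotient.mk v.asIdeal ((4 * k : ℤ) : 𝓞 K3) := by rw [hD]
    rw [hνw, hνv, hcast, jacobiSym.pow_right, ← jacobiSym.legendreSym.to_jacobiSym, map_mul, map_mul, map_mul, hreal]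
    simp only [RingHom.coe_coe, AlgHom.toRingHom_eq_coe]
    have hl : ((legendreSym p k : ℤ) : ℂ) ^ (j + 1) = ((legendreSym p k : ℤ) : ℂ) ^ a * ((legendreSym p k : ℤ) : ℂ) ^ (j + 1 - a) := by
      rw [← pow_add]; congr 1; omega
    rw [Int.cast_pow, hl]
    ring

end Main

end SexticTwist

end Literature.NumberTheory.EllipticCurves

end
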